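import Summits.Langlands.Langlands.Theses.ParityBlindBianchi
import Summits.Langlands.Langlands.Theorems.IrreducibilityBySelfDualityIrreducibleGL3CMContinuousSemisimplification
import Summits.Langlands.Langlands.Theorems.IrreducibilityBySelfDualityIrreducibleGL3CMReducibleCompanion
import Literature.NumberTheory.GaloisRepresentations.LAdicRepFrobenius
import Literature.NumberTheory.GaloisRepresentations.FramedRepEquivConj
import Literature.NumberTheory.Automorphic.ChebotarevArtinRepHolds
import Literature.NumberTheory.Automorphic.AutomorphicRepsGLSatakeFlathProofs
import HarnessLib

/-!
# Line `leaves` — `ParityBlindBianchi.EvenArtinJunction` (stmt-Langlands-2908) from the typed partition of the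
re-typed summit (crux-strategist planner-cstrat-stmt-Langlands-2908-r1-0, 2026-08-17; EXEMPT-46 re-exam, BC2 REDIRECT)

REGISTERED SKELETON of the decomposition filed for `route edit --split EvenArtinJunction` (children.json on the item;
the split itself is refused to this seat by the CLI's final-cycle rule, so the decomposition is recorded HERE as the
crux's line until an operator / final-cycle seat installs it): four stubs = the four leaves VERBATIM
(= the `statement` texts of children.json = the defs of `Lines/EvenArtinJunctionOfSubsByName.lean`), and the
kernel-checked compositions `langlands_of_leaves : N → W_irr → B_w → C∀ → Langlands` (texts) and
`EvenArtinJunction_proof : EvenArtinJunction` (stubs BY NAME), whose proof is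
the structural glue `Lines/EvenArtinJunctionOfLeaves.lean` (uniqueness up to conjugacy = Chebotarev–Brauer–Nesbitt,
inlined).  Sorries: exactly the four `stub_*`.  Each stub has its own BC3 birth (`Lines/birth_<Child>.lean`, 2 stubs each).

* `stub_reciprocityDataNonempty`  (N, IN PRINT: Harris–Taylor/Henniart + canonical Artin/ε pins — the summit's non-vacuity conjunct)
* `stub_weakExistenceIrreducible` (W_irr, OPEN: Buzzard–Gee 3.2.2 weak form with irreducibility, `𝓡`-free)
* `stub_weakAutomorphy`           (B_w, OPEN: Fontaine–Mazur–Langlands a.e.; verbatim the 10368 / 14328 leaf)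
* `stub_pairCompatibilityAll`     (C∀, OPEN: Taylor 2004 Conj. 7 for irreducible pairs, ALL reciprocity data)

HONESTY CAVEAT (census §0): the antecedent X of the crux is not used — the stubs decompose `Langlands` itself.
Disproof used: none exists for this crux (no Disproof.lean); dead line `Sketch` (0-sorry truth table) is not a
skeleton; line `dedekind_exclusion` (s1) attacks the ¬X disjunct and is independent of this one.
-/

noncomputable section

set_option linter.dupNamespace false

open scoped NumberField Classical
open Filter IsDedekindDomain
open Literature.NumberTheory.Automorphic Literature.NumberTheory.GaloisRepresentations
open Summit.Langlands

namespace Summit.Langlands.Langlands.Cruxes.EvenArtinJunction.Leaves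

/-- **stub N — reciprocity data exist over every number field** (IN PRINT; formalisation debt after the D-0032 §4c
re-type: Harris–Taylor 2001 Thm. A / Henniart 2000 + transport to the canonical Artin/ε normalisation; birth
`Lines/birth_ReciprocityDataNonempty.lean`). [cite: HarrisTaylorAMS2001, Thm. A] [cite: HenniartInventiones2000, Thm. 1.2] -/
theorem stub_reciprocityDataNonempty :
    ∀ (K : Type) [Field K] [NumberField K], Nonempty (ReciprocityData K) := by
  sorry

/-- **stub W_irr — weak existence with irreducibility** (OPEN: Buzzard–Gee Conj. 3.2.2 weak form + Taylor Conj. (A);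
open core = irregular `π`, general `K`, irreducibility; birth `Lines/birth_WeakExistenceIrreducible.lean`).
[cite: BuzzardGeeLMS2014, Conj. 3.2.2] [cite: TaylorGaloisRepresentations2004, Conj. 7] -/
theorem stub_weakExistenceIrreducible :
    ∀ (K : Type) [Field K] [NumberField K] (n : ℕ) (hcpt : Literature.NumberTheory.Automorphic.isCompact_glFiniteIntegralLevel n K), 0 < n → ∀ π : Literature.NumberTheory.Automorphic.CuspidalAutomorphicRepData n K hcpt, π.1.IsLAlgebraic → ∀ (ℓ : ℕ) [Fact ℓ.Prime] (ι : PadicAlgCl ℓ ≃+* ℂ), ∃ ρ : Literature.NumberTheory.GaloisRepresentations.FramedGaloisRep K (PadicAlgCl ℓ) n, ρ.toGaloisRep.IsIrreducible ∧ ((∀ᶠ v : IsDedekindDomain.HeightOneSpectrum (NumberField.RingOfIntegers K) in cofinite, ρ.IsUnramifiedAt v) ∧ ∀ (v : IsDedekindDomain.HeightOneSpectrum (NumberField.RingOfIntegers K)) (hv : ((ℓ : ℕ) : NumberField.RingOfIntegers K) ∈ v.asIdeal), (Literature.NumberTheory.PAdicHodge.fontainePstAdicCompletion v ℓ hv).IsDeRhamFramed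 (ρ.toLocal v)) ∧ ∀ᶠ v : IsDedekindDomain.HeightOneSpectrum (NumberField.RingOfIntegers K) in cofinite, SatakeFrobCompatibleAt ι π.1 ρ v := by
  sorry

/-- **stub B_w — weak automorphy** (OPEN: Fontaine–Mazur–Langlands, a.e. form; verbatim the leaf B_w of stmt-10368 /
stmt-14328; birth `Lines/birth_WeakAutomorphy.lean`). [cite: FontaineMazurGeometric1995, Conj. 1]
[cite: BuzzardGeeLMS2014, Conj. 3.2.2] -/
theorem stub_weakAutomorphy :
    ∀ (K : Type) [Field K] [NumberField K] (n : ℕ) (hcpt : Literature.NumberTheory.Automorphic.isCompact_glFiniteIntegralLevel n K), 0 < n → ∀ (ℓ : ℕ) [Fact ℓ.Prime] (ι : PadicAlgCl ℓ ≃+* ℂ) (ρ : Literature.NumberTheory.GaloisRepresentations.FramedGaloisRep K (PadicAlgCl ℓ) n), ρ.toGaloisRep.IsIrreducible → ((∀ᶠ v : IsDedekindDomain.HeightOneSpectrum (NumberField.RingOfIntegers K) in cofinite, ρ.IsUnramifiedAt v) ∧ ∀ (v : IsDedekindDomain.HeightOneSpectrum (NumberField.RingOfIntegers K)) (hv : ((ℓ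 : ℕ) : NumberField.RingOfIntegers K) ∈ v.asIdeal), (Literature.NumberTheory.PAdicHodge.fontainePstAdicCompletion v ℓ hv).IsDeRhamFramed (ρ.toLocal v)) → ∃ π : Literature.NumberTheory.Automorphic.CuspidalAutomorphicRepData n K hcpt, π.1.IsLAlgebraic ∧ ∀ᶠ v : IsDedekindDomain.HeightOneSpectrum (NumberField.RingOfIntegers K) in cofinite, SatakeFrobCompatibleAt ι π.1 ρ v := by
  sorry

/-- **stub C∀ — local–global compatibility for irreducible pinned-geometric a.e.-compatible pairs, ALL data**
(OPEN: Taylor 2004 Conj. 7; `∀ 𝓡` forced by the re-type; birth `Lines/birth_PairCompatibilityAll.lean`).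
[cite: TaylorGaloisRepresentations2004, Conj. 7] [cite: HarrisTaylorAMS2001, Thm. A] -/
theorem stub_pairCompatibilityAll :
    ∀ (K : Type) [Field K] [NumberField K] (Rec : ReciprocityData K) (n : ℕ) (hcpt : Literature.NumberTheory.Automorphic.isCompact_glFiniteIntegralLevel n K), 0 < n → ∀ (π : Literature.NumberTheory.Automorphic.CuspidalAutomorphicRepData n K hcpt), π.1.IsLAlgebraic → ∀ (ℓ : ℕ) [Fact ℓ.Prime] (ι : PadicAlgCl ℓ ≃+* ℂ) (ρ : Literature.NumberTheory.GaloisRepresentations.FramedGaloisRep K (PadicAlgCl ℓ) n), ρ.toGaloisRep.IsIrreducible → ((∀ᶠ v : IsDedekindDomain.HeightOneSpectrum (NumberField.RingOfIntegers K) in cofinite, ρ.IsUnramifiedAt v) ∧ ∀ (v : IsDedekindDomain.HeightOneSpectrum (NumberField.RingOfIntegers K)) (hv : ((ℓ : ℕ) : NumberField.RingOfIntegers K) ∈ v.asIdeal), (Literature.NumberTheory.PAdicHodge.fontainePstAdicCompletion v ℓ hv).IsDeRhamFramed (ρ.toLocal v)) → (∀ᶠ v : IsDedekindDomain.HeightOneSpectrum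 (NumberField.RingOfIntegers K) in cofinite, SatakeFrobCompatibleAt ι π.1 ρ v) → ∀ v : IsDedekindDomain.HeightOneSpectrum (NumberField.RingOfIntegers K), LocalGlobalCompatibleAt Rec ι π.1 ρ v := by
  sorry

variable {n : ℕ} {K : Type} [Field K] [NumberField K] {hcpt : isCompact_glFiniteIntegralLevel n K}
  {ℓ : ℕ} [Fact ℓ.Prime]

omit [NumberField K] in
/-- An irreducible continuous Galois representation on `ℚ̄_ℓⁿ` is semisimple (a simple lattice of
subrepresentations is complemented). [folklore] -/
theorem isSemisimple_of_isIrreducible (ρ : FramedGaloisRep K (PadicAlgCl ℓ) n)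
    (h : ρ.toGaloisRep.IsIrreducible) : ρ.toGaloisRep.IsSemisimple := by
  haveI := h
  change ComplementedLattice _
  infer_instance

omit [NumberField K] in
/-- Conjugate framed representations have the same characteristic polynomials
(Mathlib `Matrix.charpoly_units_conj`). [folklore] -/
theorem charpoly_conj (P : GL (Fin n) (PadicAlgCl ℓ)) (ρ : FramedGaloisRep K (PadicAlgCl ℓ) n)
    (g : Field.absoluteGaloisGroup K) :
    FramedRep.charpoly (ρ.conj P) g = FramedRep.charpoly ρ g := by
  simp only [FramedRep.charpoly, FramedRep.conj_apply, Units.val_mul, Matrix.coe_units_inv]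
  exact Matrix.charpoly_units_conj P _

/-- **Two avatars of one `π` have equal Frobenius characteristic polynomials almost everywhere**
(uniqueness of Satake parameters, Flath 1979 Thm. 3: `hasSatakeParamAt_unique_holds`). [folklore] -/
theorem eventually_hasFrobCharpolyAt_common
    (π : AutomorphicRepData (AutomorphyDatum.gl n K hcpt)) (ι : PadicAlgCl ℓ ≃+* ℂ)
    {ρ₀ r : FramedGaloisRep K (PadicAlgCl ℓ) n}
    (h₀ : ∀ᶠ v : HeightOneSpectrum (𝓞 K) in cofinite, SatakeFrobCompatibleAt ι π ρ₀ v)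
    (hr : ∀ᶠ v : HeightOneSpectrum (𝓞 K) in cofinite, SatakeFrobCompatibleAt ι π r v) :
    ∀ᶠ v : HeightOneSpectrum (𝓞 K) in cofinite,
      ρ₀.IsUnramifiedAt v ∧ r.IsUnramifiedAt v ∧
        ∃ P : Polynomial (PadicAlgCl ℓ), ρ₀.HasFrobCharpolyAt v P ∧ r.HasFrobCharpolyAt v P := by
  filter_upwards [h₀, hr] with v hv hv'
  obtain ⟨α, hα, hur, hcp⟩ := hv
  obtain ⟨α', hα', hur', hcp'⟩ := hv'
  obtain rfl : α = α' := AutomorphicRepData.hasSatakeParamAt_unique_holds π hα hα'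
  exact ⟨hur, hur', _, hcp, hcp'⟩

/-- **Chebotarev–Brauer–Nesbitt transfer of irreducibility** (every rank, every number field): if
`ρ₀, ρ : Γ_K →ₜ* GL_n(ℚ̄_ℓ)` are unramified with a COMMON Frobenius characteristic polynomial at all but
finitely many places and `ρ₀` is irreducible, then `ρ` is irreducible — a continuous semisimplification
`r` of `ρ` is equivalent to `ρ₀` (Deligne–Serre 1974, Lemme 3.2), hence conjugate to it, so `ρ` and `ρ₀`
have the same characteristic polynomials everywhere, and Brauer–Nesbitt. (Inlined from the
`IrreducibleOffSector` transfer module, which is in drift after D-0032 §4c.)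
[cite: DeligneSerreASENS1974, Lemme 3.2] -/
theorem isIrreducible_of_eventually_hasFrobCharpolyAt_common
    {ρ₀ ρ : FramedGaloisRep K (PadicAlgCl ℓ) n} (hirr₀ : ρ₀.toGaloisRep.IsIrreducible)
    (h : ∀ᶠ v : HeightOneSpectrum (𝓞 K) in cofinite,
      ρ₀.IsUnramifiedAt v ∧ ρ.IsUnramifiedAt v ∧
        ∃ P : Polynomial (PadicAlgCl ℓ), ρ₀.HasFrobCharpolyAt v P ∧ ρ.HasFrobCharpolyAt v P) :
    ρ.toGaloisRep.IsIrreducible := by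
  obtain ⟨r, hrss, hrcp, hrker⟩ := Summit.Langlands.Langlands.Theorems.IrreducibleGL3CM.stub_continuousSemisimplification K ℓ n ρ
  have hr : ∀ᶠ v : HeightOneSpectrum (𝓞 K) in cofinite,
      ρ₀.IsUnramifiedAt v ∧ r.IsUnramifiedAt v ∧
        ∃ P : Polynomial (PadicAlgCl ℓ), ρ₀.HasFrobCharpolyAt v P ∧ r.HasFrobCharpolyAt v P := by
    filter_upwards [h] with v hv
    obtain ⟨hur₀, hur, P, hcp₀, hcp⟩ := hv
    exact ⟨hur₀, fun 𝔓 h𝔓 σ hσ => hrker σ (hur 𝔓 h𝔓 σ hσ), P, hcp₀,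
      fun 𝔓 h𝔓 σ hσ => (hrcp σ).trans (hcp 𝔓 h𝔓 σ hσ)⟩
  obtain ⟨e⟩ := FramedGaloisRep.nonempty_equiv_of_hasFrobCharpolyAt_eventually
    chebotarev_artinRep_holds ρ₀ r (isSemisimple_of_isIrreducible ρ₀ hirr₀) hrss hr
  obtain ⟨P, hP⟩ := FramedRep.exists_eq_conj_of_equiv ρ₀ r e
  have hcp : ∀ g, FramedRep.charpoly ρ₀ g = FramedRep.charpoly ρ g := fun g => by
    rw [← hrcp g, hP, charpoly_conj]
  by_contra hirr
  exact Summit.Langlands.Langlands.Theorems.IrreducibleGL3CM.stub_not_isIrreducible_of_charpoly_eq K ℓ n ρ ρ₀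
    (isSemisimple_of_isIrreducible ρ₀ hirr₀) hcp hirr hirr₀

/-- **Uniqueness up to conjugacy of the avatar** (the last clause of (A)): if `ρ` is irreducible and
`ρ, ρ'` are both Satake–Frobenius compatible with `(π, ι)` at almost all places, then `ρ'` is a
`GL_n(ℚ̄_ℓ)`-conjugate of `ρ` — `ρ'` is irreducible by the transfer above, both are semisimple with equal
Frobenius polynomials a.e., hence equivalent (Chebotarev + Brauer–Nesbitt) and conjugate.
[cite: DeligneSerreASENS1974, Lemme 3.2] -/
theorem isConjugate_of_satakeFrobCompatible
    (π : AutomorphicRepData (AutomorphyDatum.gl n K hcpt)) (ι : PadicAlgCl ℓ ≃+* ℂ)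
    {ρ ρ' : FramedGaloisRep K (PadicAlgCl ℓ) n} (hirr : ρ.toGaloisRep.IsIrreducible)
    (hρ : ∀ᶠ v : HeightOneSpectrum (𝓞 K) in cofinite, SatakeFrobCompatibleAt ι π ρ v)
    (hρ' : ∀ᶠ v : HeightOneSpectrum (𝓞 K) in cofinite, SatakeFrobCompatibleAt ι π ρ' v) :
    IsConjugate ρ ρ' := by
  have hev := eventually_hasFrobCharpolyAt_common π ι hρ hρ'
  have hirr' : ρ'.toGaloisRep.IsIrreducible :=
    isIrreducible_of_eventually_hasFrobCharpolyAt_common hirr hev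
  obtain ⟨e⟩ := FramedGaloisRep.nonempty_equiv_of_hasFrobCharpolyAt_eventually
    chebotarev_artinRep_holds ρ ρ' (isSemisimple_of_isIrreducible ρ hirr)
    (isSemisimple_of_isIrreducible ρ' hirr') hev
  obtain ⟨P, hP⟩ := FramedRep.exists_eq_conj_of_equiv ρ ρ' e
  exact ⟨P, hP.symm⟩

/-- **The SUMMIT from the four stub statements** (composition with the stub TEXTS as hypotheses; this is the
structural glue `Lines/EvenArtinJunctionOfLeaves.lean` without the idle antecedent): N gives the non-vacuity
conjunct; at every `𝓡`, (A) = W_irr + C∀ + uniqueness up to conjugacy (`isConjugate_of_satakeFrobCompatible`),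
(B) = B_w + C∀. [cite: BuzzardGeeLMS2014, Conj. 3.2.1 and Conj. 3.2.2] [cite: DeligneSerreASENS1974, Lemme 3.2] -/
theorem langlands_of_leaves :
    (∀ (K : Type) [Field K] [NumberField K], Nonempty (ReciprocityData K)) →
    (∀ (K : Type) [Field K] [NumberField K] (n : ℕ) (hcpt : Literature.NumberTheory.Automorphic.isCompact_glFiniteIntegralLevel n K), 0 < n → ∀ π : Literature.NumberTheory.Automorphic.CuspidalAutomorphicRepData n K hcpt, π.1.IsLAlgebraic → ∀ (ℓ : ℕ) [Fact ℓ.Prime] (ι : PadicAlgCl ℓ ≃+* ℂ), ∃ ρ : Literature.NumberTheory.GaloisRepresentations.FramedGaloisRep K (PadicAlgCl ℓ) n, ρ.toGaloisRep.IsIrreducible ∧ ((∀ᶠ v : IsDedekindDomain.HeightOneSpectrum (NumberField.RingOfIntegers K) in cofinite, ρ.IsUnramifiedAt v) ∧ ∀ (v : IsDedekindDomain.HeightOneSpectrum (NumberField.RingOfIntegers K)) (hv : ((ℓ : ℕ) : NumberField.RingOfIntegers K) ∈ v.asIdeal), (Literature.NumberTheory.PAdicHodge.fontainePstAdicCompletion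 v ℓ hv).IsDeRhamFramed (ρ.toLocal v)) ∧ ∀ᶠ v : IsDedekindDomain.HeightOneSpectrum (NumberField.RingOfIntegers K) in cofinite, SatakeFrobCompatibleAt ι π.1 ρ v) →
    (∀ (K : Type) [Field K] [NumberField K] (n : ℕ) (hcpt : Literature.NumberTheory.Automorphic.isCompact_glFiniteIntegralLevel n K), 0 < n → ∀ (ℓ : ℕ) [Fact ℓ.Prime] (ι : PadicAlgCl ℓ ≃+* ℂ) (ρ : Literature.NumberTheory.GaloisRepresentations.FramedGaloisRep K (PadicAlgCl ℓ) n), ρ.toGaloisRep.IsIrreducible → ((∀ᶠ v : IsDedekindDomain.HeightOneSpectrum (NumberField.RingOfIntegers K) in cofinite, ρ.IsUnramifiedAt v) ∧ ∀ (v : IsDedekindDomain.HeightOneSpectrum (NumberField.RingOfIntegers K)) (hv : ((ℓ : ℕ) : NumberField.RingOfIntegers K) ∈ v.asIdeal), (Literature.NumberTheory.PAdicHodge.fontainePstAdicCompletion v ℓ hv).IsDeRhamFramed (ρ.toLocal v)) → ∃ π : Literature.NumberTheory.Automorphic.CuspidalAutomorphicRepData n K hcpt, π.1.IsLAlgebraic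 ∧ ∀ᶠ v : IsDedekindDomain.HeightOneSpectrum (NumberField.RingOfIntegers K) in cofinite, SatakeFrobCompatibleAt ι π.1 ρ v) →
    (∀ (K : Type) [Field K] [NumberField K] (Rec : ReciprocityData K) (n : ℕ) (hcpt : Literature.NumberTheory.Automorphic.isCompact_glFiniteIntegralLevel n K), 0 < n → ∀ (π : Literature.NumberTheory.Automorphic.CuspidalAutomorphicRepData n K hcpt), π.1.IsLAlgebraic → ∀ (ℓ : ℕ) [Fact ℓ.Prime] (ι : PadicAlgCl ℓ ≃+* ℂ) (ρ : Literature.NumberTheory.GaloisRepresentations.FramedGaloisRep K (PadicAlgCl ℓ) n), ρ.toGaloisRep.IsIrreducible → ((∀ᶠ v : IsDedekindDomain.HeightOneSpectrum (NumberField.RingOfIntegers K) in cofinite, ρ.IsUnramifiedAt v) ∧ ∀ (v : IsDedekindDomain.HeightOneSpectrum (NumberField.RingOfIntegers K)) (hv : ((ℓ : ℕ) : NumberField.RingOfIntegers K) ∈ v.asIdeal), (Literature.NumberTheory.PAdicHodge.fontainePstAdicCompletion v ℓ hv).IsDeRhamFramed (ρ.toLocal v)) → (∀ᶠ v : IsDedekindDomain.HeightOneSpectrum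 (NumberField.RingOfIntegers K) in cofinite, SatakeFrobCompatibleAt ι π.1 ρ v) → ∀ v : IsDedekindDomain.HeightOneSpectrum (NumberField.RingOfIntegers K), LocalGlobalCompatibleAt Rec ι π.1 ρ v) →
    _root_.Langlands := by
  intro hN hW hB hC F _ _
  refine ⟨hN F, fun 𝓡 n hn hcpt => ⟨?_, ?_⟩⟩
  · intro π hL ℓ _ ι
    obtain ⟨ρ, hirr, hgeo, hρ⟩ := hW F n hcpt hn π hL ℓ ι
    have hcorr : Corresponds 𝓡 ι π.1 ρ := ⟨hρ, hC F 𝓡 n hcpt hn π hL ℓ ι ρ hirr hgeo hρ⟩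
    exact ⟨ρ, hirr, hgeo, hcorr,
      fun ρ' hcorr' => isConjugate_of_satakeFrobCompatible π.1 ι hirr hρ hcorr'.1⟩
  · intro ℓ _ ι ρ hirr hgeo
    obtain ⟨π, hL, hρ⟩ := hB F n hcpt hn ℓ ι ρ hirr hgeo
    exact ⟨π, hL, hρ, hC F 𝓡 n hcpt hn π hL ℓ ι ρ hirr hgeo hρ⟩

/-- **REGISTERED CERTIFICATE — the crux modulo exactly the four stubs, BY NAME**: discard the antecedent X (even
icosahedral strong Artin) and apply `langlands_of_leaves` to the stubs.  (The only theorem of this file concluding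
the crux; the curried text form `N → W_irr → B_w → C∀ → EvenArtinJunction` is `Lines/EvenArtinJunctionOfLeaves.lean`.) -/
theorem EvenArtinJunction_proof : Summit.Langlands.Langlands.Theses.ParityBlindBianchi.EvenArtinJunction :=
  fun _hX => langlands_of_leaves stub_reciprocityDataNonempty stub_weakExistenceIrreducible stub_weakAutomorphy
    stub_pairCompatibilityAll

end Summit.Langlands.Langlands.Cruxes.EvenArtinJunction.Leaves

end
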